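import Literature.NumberTheory.Automorphic.MeyerSummationPoisson
import Literature.NumberTheory.Automorphic.IdelicThetaSumIntegrability
import HarnessLib

/-!
# Tate's truncated zeta integral at `s = 1`, zeta-free form (Rogawski's Lemma 7.1.1, trivial `χ`)

Topic `NumberTheory/Automorphic`; namespace `Literature.NumberTheory.Automorphic`. THEOREMS ONLY
(no definition, no instance, no notation, no named fact, no `sorry`). For a number field `K`, the
self-dual additive Haar measure `μ` on `𝔸_K` (`μ(𝔸_K ⧸ K) = 1`), ANY Haar measure `ν` on the idele
group `𝕀_K`, a strict measurable fundamental domain `𝓕 ⊆ 𝕀_K` for `Kˣ` (`IsIdeleClassDomain`,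
`IdeleClassIntegration`), a Bruhat–Schwartz function `f ∈ 𝒮(𝔸_K)` (`Meyer.schwartzBruhatAdele`)
and a cut-off `T > 0`, Rogawski's integral [Rogawski1990, §7.1 Lemma 7.1.1]

  `I_T(f) = ∫_{Kˣ\𝕀_K} [ Σ_{a ∈ Kˣ} f(a x) − ‖x‖⁻¹ · 1_{‖x‖ < T⁻¹} · 𝔉f(0) ] ‖x‖ dν(x)`

(`Σ_{a ∈ Kˣ} f(a x) = Meyer.ideleSum K f x`, `𝔉f = Meyer.adeleFourier K μ f`, `‖x‖` the idele
norm; Rogawski's `τ(ln |a|⁻¹ − T)` is `1_{‖x‖ < e^{−T}}`, so our `T` is his `e^T`) converges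
absolutely and equals

  `I_T(f) = V · log T · 𝔉f(0) + A(f) + Â(f) − V · f(0)`,

with `V = idelicCovolume K ν` the disintegration constant of `ν` along `log ‖x‖`
(`= m(Kˣ\𝕀_K¹)`, Rogawski's `λ_{-1}` for his `d^*a`; characterised zeta-free by
`lintegral_comp_logNorm_eq`), `A(f) = ∫_{𝓕 ∩ {‖x‖ ≥ 1}} Σf(x) ‖x‖ dν` and
`Â(f) = ∫_{𝓕 ∩ {‖x‖ ≥ 1}} Σ(𝔉f)(x) dν`, both absolutely convergent
(`IdelicThetaSumIntegrability`). This is the `T`-slope / constant-term content of Lemma 7.1.1 (b)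
WITHOUT the zeta function: the identification of the constant `A(f) + Â(f) − V f(0)` with
`λ₀ 𝔉f(0) + λ_{-1} Σ_v (…)′(1)` (Euler product and Laurent data of `ζ_K` at `s = 1`) is not made
here. Route = Tate's proof of the Main Theorem 4.4.1 [CasselsFrohlichANT1967, Ch. XV §4.4]: split
at `‖x‖ = 1`; below, Poisson summation along the idele `x` in Meyer's form
`f(0) + Σf(x) = ‖x‖⁻¹ (𝔉f(0) + Σ(𝔉f)(x⁻¹))` (`Meyer.add_ideleSum_eq`, [Meyer2005, §5.4]);
`x ↦ x⁻¹` (a Haar measure on the commutative `𝕀_K` is inversion invariant) and independence of the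
fundamental domain for the `Kˣ`-invariant dual sum; then the two volume formulas of
`IdelicThetaSumIntegrability`.

* **`integrableOn_and_setIntegral_ideleSum_inv`** — the reflection
  `∫_{𝓕 ∩ {‖x‖<1}} Σg(x⁻¹) dν = ∫_{𝓕 ∩ {‖x‖≥1}} Σg(x) dν` for `g ∈ 𝒮(𝔸_K)`;
* `ideleSum_mul_ideleNorm_eq` — `Σf(x)‖x‖ = 𝔉f(0) + Σ(𝔉f)(x⁻¹) − f(0)‖x‖`;
  `tateTruncated_integrand_eq` — the pointwise decomposition of the truncated integrand;
* **`integrableOn_and_setIntegral_tateTruncated`** — the lemma (convergence and value).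

Cell `hodgecm-mathlib`, ENGINE T1 LAW 5 row (L5-i) (F0P3a-plan (g5) RULING #114; B-p17 (g18)
piece E, the Heisenberg part of [Rogawski1990, Prop. 7.3.2]; also (L5-iii-c) [Prop. 7.2.2]):
consumed by name there with `f := ψ_f`. HC_CM is proved only modulo the 7 printed citations until
rung 0 closes — nothing here bears on a summit statement.

## References
* [Rogawski1990] J. D. Rogawski, *Automorphic Representations of Unitary Groups in Three
  Variables*, Ann. of Math. Stud. 123 (1990), §7.1, Lemma 7.1.1 (Ch. 7 opening pages).
* [CasselsFrohlichANT1967] J. Tate, *Fourier analysis in number fields and Hecke's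
  zeta-functions*, in Cassels–Fröhlich (eds.), *Algebraic Number Theory* (1967), Ch. XV, §4.4,
  proof of Thm. 4.4.1.
* [Meyer2005] R. Meyer, *On a representation of the idele class group related to primes and zeros
  of L-functions*, Duke Math. J. 127 (2005), §5.3–5.4.
-/

set_option autoImplicit false

noncomputable section

open MeasureTheory MeasureTheory.Measure NumberField IsDedekindDomain Set Filter
open scoped ENNReal NNReal Classical
open Literature.NumberTheory.Automorphic.Meyer

namespace Literature.NumberTheory.Automorphic

variable {K : Type} [Field K] [NumberField K]

/-! ### The dual piece: inversion `x ↦ x⁻¹` and change of fundamental domain -/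

section Dual

/-- `1_{‖x‖ > 1} · Σg` is invariant under the principal ideles (product formula and
`Σg(kx) = Σg(x)`). [folklore] -/
private theorem indicator_ideleSum_principal_smul (g : AdeleRing (𝓞 K) K → ℂ)
    (k : GaloisRepresentations.principalIdeles K) (x : GaloisRepresentations.ideleGroup K) :
    {x : GaloisRepresentations.ideleGroup K | 1 < (IdeleClassGroup.ideleNorm K x : ℝ)}.indicator
        (ideleSum K g) (k • x) =
      {x : GaloisRepresentations.ideleGroup K | 1 < (IdeleClassGroup.ideleNorm K x : ℝ)}.indicator
        (ideleSum K g) x := by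
  obtain ⟨c, hc⟩ := k.2
  have hkx : k • x =
      x * Units.map (algebraMap K (AdeleRing (𝓞 K) K) : K →* AdeleRing (𝓞 K) K) c := by
    rw [Subgroup.smul_def, smul_eq_mul, mul_comm, hc]
  have hnorm : (IdeleClassGroup.ideleNorm K (k • x) : ℝ) = (IdeleClassGroup.ideleNorm K x : ℝ) := by
    rw [Subgroup.smul_def, smul_eq_mul, map_mul, ideleNorm_principal k.2, one_mul]
  have hmem : (k • x ∈ {x : GaloisRepresentations.ideleGroup K |
      1 < (IdeleClassGroup.ideleNorm K x : ℝ)}) ↔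
      x ∈ {x : GaloisRepresentations.ideleGroup K | 1 < (IdeleClassGroup.ideleNorm K x : ℝ)} := by
    simp only [mem_setOf_eq, hnorm]
  by_cases hx : x ∈ {x : GaloisRepresentations.ideleGroup K | 1 < (IdeleClassGroup.ideleNorm K x : ℝ)}
  · rw [indicator_of_mem hx, indicator_of_mem (hmem.2 hx), hkx, ideleSum_mul_principal]
  · rw [indicator_of_notMem hx, indicator_of_notMem (fun h => hx (hmem.1 h))]

variable [MeasurableSpace (GaloisRepresentations.ideleGroup K)]
  [BorelSpace (GaloisRepresentations.ideleGroup K)]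
  (ν : Measure (GaloisRepresentations.ideleGroup K)) [ν.IsHaarMeasure]
  {𝓕 : Set (GaloisRepresentations.ideleGroup K)}

/-- A Haar measure on the (commutative) idele group is inversion invariant. [folklore] -/
private theorem isInvInvariant_idele : ν.IsInvInvariant := by
  haveI := locallyCompactSpace_ideleGroup K
  haveI := secondCountableTopology_ideleGroup K
  haveI := t2Space_ideleGroup K
  haveI : ν.Regular := inferInstance
  infer_instance

/-- **The dual piece**: for `g ∈ 𝒮(𝔸_K)` (think `g = 𝔉f`), `x ↦ Σg(x⁻¹)` is integrable on
`𝓕 ∩ {‖x‖ < 1}` and `∫_{𝓕 ∩ {‖x‖ < 1}} Σg(x⁻¹) dν(x) = ∫_{𝓕 ∩ {‖x‖ ≥ 1}} Σg(x) dν(x)`: substitute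
`x ↦ x⁻¹` (`ν` is inversion invariant), land in the fundamental domain `𝓕⁻¹`, and move back to `𝓕`
by the `Kˣ`-invariance of `1_{‖x‖>1} Σg` (independence of the fundamental domain); the shell
`‖x‖ = 1` is null. This is Tate's "`∫_{|𝔞|<1} … = ∫_{|𝔟|>1} …`" reflection.
[cite: CasselsFrohlichANT1967, Ch. XV Thm. 4.4.1 (proof)] -/
theorem integrableOn_and_setIntegral_ideleSum_inv (h𝓕 : IsIdeleClassDomain K 𝓕)
    {g : AdeleRing (𝓞 K) K → ℂ} (hg : g ∈ schwartzBruhatAdele K) :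
    IntegrableOn (fun x => ideleSum K g x⁻¹)
        ({x | (IdeleClassGroup.ideleNorm K x : ℝ) < 1} ∩ 𝓕) ν ∧
      ∫ x in {x | (IdeleClassGroup.ideleNorm K x : ℝ) < 1} ∩ 𝓕, ideleSum K g x⁻¹ ∂ν =
        ∫ x in {x | 1 ≤ (IdeleClassGroup.ideleNorm K x : ℝ)} ∩ 𝓕, ideleSum K g x ∂ν := by
  haveI := secondCountableTopology_ideleGroup K
  haveI : MeasurableMul (GaloisRepresentations.ideleGroup K) := inferInstance
  haveI : MeasurableInv (GaloisRepresentations.ideleGroup K) := inferInstance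
  haveI := isInvInvariant_idele ν
  -- names
  set L : Set (GaloisRepresentations.ideleGroup K) :=
    {x | (IdeleClassGroup.ideleNorm K x : ℝ) < 1} with hL
  set G' : Set (GaloisRepresentations.ideleGroup K) :=
    {x | 1 < (IdeleClassGroup.ideleNorm K x : ℝ)} with hG'
  set G : Set (GaloisRepresentations.ideleGroup K) :=
    {x | 1 ≤ (IdeleClassGroup.ideleNorm K x : ℝ)} with hG
  have hcont : Continuous fun x : GaloisRepresentations.ideleGroup K =>
      (IdeleClassGroup.ideleNorm K x : ℝ) :=
    NNReal.continuous_coe.comp (continuous_ideleNorm_holds K)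
  have hLm : MeasurableSet L := measurableSet_lt hcont.measurable measurable_const
  have hG'm : MeasurableSet G' := measurableSet_lt measurable_const hcont.measurable
  have h𝓕m : MeasurableSet 𝓕 := h𝓕.measurableSet
  -- `L⁻¹ = G'`
  have hLinv : L⁻¹ = G' := by
    ext x
    rw [Set.mem_inv]
    simp only [hL, hG', mem_setOf_eq, map_inv, NNReal.coe_inv]
    exact inv_lt_one₀ (ideleNorm_real_pos x)
  set Sg := ideleSum K g with hSg
  -- the integrand supported in `L ∩ 𝓕` is the reflection of `1_{G' ∩ 𝓕⁻¹} Σg`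
  have hH : (L ∩ 𝓕).indicator (fun x => Sg x⁻¹) = ((G' ∩ 𝓕⁻¹).indicator Sg) ∘ Inv.inv := by
    funext x
    simp only [Function.comp_apply]
    have hiff : x ∈ L ∩ 𝓕 ↔ x⁻¹ ∈ G' ∩ 𝓕⁻¹ := by
      rw [← hLinv, ← Set.inter_inv, Set.mem_inv, inv_inv]
    by_cases hx : x ∈ L ∩ 𝓕
    · rw [indicator_of_mem hx, indicator_of_mem (hiff.1 hx)]
    · rw [indicator_of_notMem hx, indicator_of_notMem (fun h => hx (hiff.2 h))]
  -- `1_{G'} Σg` is integrable on `𝓕`, hence on the fundamental domain `𝓕⁻¹`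
  have hsub : G' ∩ 𝓕 ⊆ G ∩ 𝓕 :=
    inter_subset_inter_left _ fun x (hx : 1 < (IdeleClassGroup.ideleNorm K x : ℝ)) =>
      (le_of_lt hx : 1 ≤ (IdeleClassGroup.ideleNorm K x : ℝ))
  have hφ𝓕 : IntegrableOn (G'.indicator Sg) 𝓕 ν := by
    rw [IntegrableOn, integrable_indicator_iff hG'm, IntegrableOn, Measure.restrict_restrict hG'm]
    exact (integrableOn_ideleSum ν h𝓕 hg).mono_set hsub
  have hinvar : ∀ (k : GaloisRepresentations.principalIdeles K)
      (x : GaloisRepresentations.ideleGroup K), G'.indicator Sg (k • x) = G'.indicator Sg x :=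
    fun k x => indicator_ideleSum_principal_smul g k x
  have hφinv : IntegrableOn (G'.indicator Sg) 𝓕⁻¹ ν :=
    ((h𝓕.inv.isFundamentalDomain ν).integrableOn_iff (h𝓕.isFundamentalDomain ν) hinvar).2 hφ𝓕
  have hI : Integrable ((G' ∩ 𝓕⁻¹).indicator Sg) ν := by
    rw [integrable_indicator_iff (hG'm.inter h𝓕m.inv)]
    have h2 := hφinv
    rw [IntegrableOn, integrable_indicator_iff hG'm, IntegrableOn,
      Measure.restrict_restrict hG'm] at h2
    exact h2
  refine ⟨?_, ?_⟩
  · -- integrability, through the measure-preserving inversion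
    rw [← integrable_indicator_iff (hLm.inter h𝓕m), hH]
    have h2 : Integrable ((G' ∩ 𝓕⁻¹).indicator Sg)
        (Measure.map (MeasurableEquiv.inv (GaloisRepresentations.ideleGroup K)) ν) := by
      rw [show ((MeasurableEquiv.inv (GaloisRepresentations.ideleGroup K) : _ ≃ᵐ _) : _ → _) =
          Inv.inv from rfl, Measure.map_inv_eq_self]
      exact hI
    exact (integrable_map_equiv _ _).1 h2
  · calc ∫ x in L ∩ 𝓕, Sg x⁻¹ ∂ν
        = ∫ x, (L ∩ 𝓕).indicator (fun x => Sg x⁻¹) x ∂ν := (integral_indicator (hLm.inter h𝓕m)).symm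
      _ = ∫ x, ((G' ∩ 𝓕⁻¹).indicator Sg) x⁻¹ ∂ν := by rw [hH]; rfl
      _ = ∫ x, (G' ∩ 𝓕⁻¹).indicator Sg x ∂ν := integral_inv_eq_self _ ν
      _ = ∫ x in 𝓕⁻¹ ∩ G', Sg x ∂ν := by rw [integral_indicator (hG'm.inter h𝓕m.inv), inter_comm]
      _ = ∫ x in 𝓕⁻¹, G'.indicator Sg x ∂ν := (setIntegral_indicator hG'm).symm
      _ = ∫ x in 𝓕, G'.indicator Sg x ∂ν :=
          (h𝓕.inv.isFundamentalDomain ν).setIntegral_eq (h𝓕.isFundamentalDomain ν) hinvar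
      _ = ∫ x in G' ∩ 𝓕, Sg x ∂ν := by rw [setIntegral_indicator hG'm, inter_comm]
      _ = ∫ x in G ∩ 𝓕, Sg x ∂ν := setIntegral_congr_set (setOf_one_lt_ideleNorm_inter_ae_eq ν h𝓕)

end Dual

/-! ### The lemma -/

section Main

variable [MeasurableSpace (AdeleRing (𝓞 K) K)] [BorelSpace (AdeleRing (𝓞 K) K)]
  (μ : Measure (AdeleRing (𝓞 K) K)) [μ.IsAddHaarMeasure]

/-- **Poisson summation along an idele, rearranged**: for `f ∈ 𝒮(𝔸_K)` and the self-dual `μ`,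
`Σf(x) ‖x‖ = 𝔉f(0) + Σ(𝔉f)(x⁻¹) − f(0) ‖x‖` ("`Σ_{t∈F*} ψ(at) − |a|⁻¹ ψ̂(0) =
|a|⁻¹ Σ_{t∈F*} ψ̂(a⁻¹t) − ψ(0)`", multiplied by `|a|`). [cite: Rogawski1990, §7.1 Lemma 7.1.1 (proof)]
[cite: Meyer2005, §5.4] -/
theorem ideleSum_mul_ideleNorm_eq (hμ : μ (adeleFundamentalDomain K) = 1)
    {f : AdeleRing (𝓞 K) K → ℂ} (hf : f ∈ schwartzBruhatAdele K)
    (x : GaloisRepresentations.ideleGroup K) :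
    ideleSum K f x * ((IdeleClassGroup.ideleNorm K x : ℝ) : ℂ) =
      adeleFourier K μ f 0 + ideleSum K (adeleFourier K μ f) x⁻¹ -
        f 0 * ((IdeleClassGroup.ideleNorm K x : ℝ) : ℂ) := by
  have h := add_ideleSum_eq μ hμ hf x
  have hN : ((IdeleClassGroup.ideleNorm K x : ℝ) : ℂ) ≠ 0 := by
    exact_mod_cast (ideleNorm_real_pos x).ne'
  calc ideleSum K f x * ((IdeleClassGroup.ideleNorm K x : ℝ) : ℂ)
      = (f 0 + ideleSum K f x) * ((IdeleClassGroup.ideleNorm K x : ℝ) : ℂ) -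
          f 0 * ((IdeleClassGroup.ideleNorm K x : ℝ) : ℂ) := by ring
    _ = ((IdeleClassGroup.ideleNorm K x : ℝ) : ℂ)⁻¹ *
          (adeleFourier K μ f 0 + ideleSum K (adeleFourier K μ f) x⁻¹) *
          ((IdeleClassGroup.ideleNorm K x : ℝ) : ℂ) - f 0 * ((IdeleClassGroup.ideleNorm K x : ℝ) : ℂ) := by
        rw [h]
    _ = adeleFourier K μ f 0 + ideleSum K (adeleFourier K μ f) x⁻¹ -
          f 0 * ((IdeleClassGroup.ideleNorm K x : ℝ) : ℂ) := by
        rw [mul_comm _⁻¹, inv_mul_cancel_right₀ hN]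

/-- **The truncated integrand, decomposed** (pointwise on `𝕀_K`): with `c = 𝔉f(0)`,
`(Σf(x) − ‖x‖⁻¹ 1_{‖x‖<T⁻¹} c) ‖x‖ = 1_{‖x‖≥1} Σf(x)‖x‖ + 1_{‖x‖<1} Σ(𝔉f)(x⁻¹)
  + (1_{‖x‖<1} − 1_{‖x‖<T⁻¹}) c − 1_{‖x‖<1} f(0)‖x‖` (Poisson below the unit norm).
[cite: Rogawski1990, §7.1 Lemma 7.1.1 (proof)] -/
theorem tateTruncated_integrand_eq (hμ : μ (adeleFundamentalDomain K) = 1)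
    {f : AdeleRing (𝓞 K) K → ℂ} (hf : f ∈ schwartzBruhatAdele K) (T : ℝ)
    (x : GaloisRepresentations.ideleGroup K) :
    (ideleSum K f x - ((IdeleClassGroup.ideleNorm K x : ℝ) : ℂ)⁻¹ *
        {x : GaloisRepresentations.ideleGroup K | (IdeleClassGroup.ideleNorm K x : ℝ) < T⁻¹}.indicator
          (fun _ => adeleFourier K μ f 0) x) * ((IdeleClassGroup.ideleNorm K x : ℝ) : ℂ) =
      {x : GaloisRepresentations.ideleGroup K | 1 ≤ (IdeleClassGroup.ideleNorm K x : ℝ)}.indicator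
          (fun x => ideleSum K f x * ((IdeleClassGroup.ideleNorm K x : ℝ) : ℂ)) x +
        {x : GaloisRepresentations.ideleGroup K | (IdeleClassGroup.ideleNorm K x : ℝ) < 1}.indicator
          (fun x => ideleSum K (adeleFourier K μ f) x⁻¹) x +
        ({x : GaloisRepresentations.ideleGroup K | (IdeleClassGroup.ideleNorm K x : ℝ) < 1}.indicator
            (fun _ => adeleFourier K μ f 0) x -
          {x : GaloisRepresentations.ideleGroup K | (IdeleClassGroup.ideleNorm K x : ℝ) < T⁻¹}.indicator
            (fun _ => adeleFourier K μ f 0) x) -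
        {x : GaloisRepresentations.ideleGroup K | (IdeleClassGroup.ideleNorm K x : ℝ) < 1}.indicator
          (fun x => f 0 * ((IdeleClassGroup.ideleNorm K x : ℝ) : ℂ)) x := by
  have hN : ((IdeleClassGroup.ideleNorm K x : ℝ) : ℂ) ≠ 0 := by
    exact_mod_cast (ideleNorm_real_pos x).ne'
  rw [sub_mul, mul_comm ((IdeleClassGroup.ideleNorm K x : ℝ) : ℂ)⁻¹, inv_mul_cancel_right₀ hN]
  by_cases hx : (IdeleClassGroup.ideleNorm K x : ℝ) < 1
  · have hx' : ¬ x ∈ {x : GaloisRepresentations.ideleGroup K | 1 ≤ (IdeleClassGroup.ideleNorm K x : ℝ)} :=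
      fun h => not_le.2 hx h
    have hxL : x ∈ {x : GaloisRepresentations.ideleGroup K | (IdeleClassGroup.ideleNorm K x : ℝ) < 1} := hx
    rw [indicator_of_notMem hx', indicator_of_mem hxL, indicator_of_mem hxL, indicator_of_mem hxL,
      ideleSum_mul_ideleNorm_eq μ hμ hf x]
    ring
  · have hx' : x ∈ {x : GaloisRepresentations.ideleGroup K | 1 ≤ (IdeleClassGroup.ideleNorm K x : ℝ)} :=
      not_lt.1 hx
    have hxL : ¬ x ∈ {x : GaloisRepresentations.ideleGroup K | (IdeleClassGroup.ideleNorm K x : ℝ) < 1} := hx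
    rw [indicator_of_mem hx', indicator_of_notMem hxL, indicator_of_notMem hxL,
      indicator_of_notMem hxL]
    ring

variable [MeasurableSpace (GaloisRepresentations.ideleGroup K)]
  [BorelSpace (GaloisRepresentations.ideleGroup K)]
  (ν : Measure (GaloisRepresentations.ideleGroup K)) [ν.IsHaarMeasure]
  {𝓕 : Set (GaloisRepresentations.ideleGroup K)}

/-- **Rogawski's Lemma 7.1.1 (trivial character), zeta-free form — Tate's truncated zeta integral
at `s = 1`.** For the self-dual Haar measure `μ` on `𝔸_K`, any Haar measure `ν` on `𝕀_K`, an
idele class domain `𝓕`, `f ∈ 𝒮(𝔸_K)` and `T > 0`: the function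
`x ↦ (Σ_{a∈Kˣ} f(ax) − ‖x‖⁻¹ 1_{‖x‖<T⁻¹} 𝔉f(0)) ‖x‖` is `ν`-integrable on `𝓕` ("the integral
… converges"), and
`∫_𝓕 (Σf(x) − ‖x‖⁻¹ 1_{‖x‖<T⁻¹} 𝔉f(0)) ‖x‖ dν
  = V log T · 𝔉f(0) + (∫_{𝓕∩{‖x‖≥1}} Σf(x)‖x‖ dν + ∫_{𝓕∩{‖x‖≥1}} Σ(𝔉f)(x) dν − V f(0))`,
`V = idelicCovolume K ν` (`= λ_{-1}` = `m(F*\I_F¹)` in print, for Rogawski's `d^*a`); the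
bracket is the `T`-free constant (print: `λ₀ψ̂(0) + λ_{-1}Σ_v(…)′(1)`, an identification through
`ζ_K` not made here). Our `T` is `e^{T}` of the printed statement.
[cite: Rogawski1990, §7.1 Lemma 7.1.1]
[cite: CasselsFrohlichANT1967, Ch. XV Thm. 4.4.1 (proof)] -/
theorem integrableOn_and_setIntegral_tateTruncated (hμ : μ (adeleFundamentalDomain K) = 1)
    (h𝓕 : IsIdeleClassDomain K 𝓕) {f : AdeleRing (𝓞 K) K → ℂ} (hf : f ∈ schwartzBruhatAdele K)
    {T : ℝ} (hT : 0 < T) :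
    IntegrableOn (fun x => (ideleSum K f x - ((IdeleClassGroup.ideleNorm K x : ℝ) : ℂ)⁻¹ *
        {x : GaloisRepresentations.ideleGroup K | (IdeleClassGroup.ideleNorm K x : ℝ) < T⁻¹}.indicator
          (fun _ => adeleFourier K μ f 0) x) * ((IdeleClassGroup.ideleNorm K x : ℝ) : ℂ)) 𝓕 ν ∧
      ∫ x in 𝓕, (ideleSum K f x - ((IdeleClassGroup.ideleNorm K x : ℝ) : ℂ)⁻¹ *
          {x : GaloisRepresentations.ideleGroup K | (IdeleClassGroup.ideleNorm K x : ℝ) < T⁻¹}.indicator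
            (fun _ => adeleFourier K μ f 0) x) * ((IdeleClassGroup.ideleNorm K x : ℝ) : ℂ) ∂ν =
        (((idelicCovolume K ν).toReal * Real.log T : ℝ) : ℂ) * adeleFourier K μ f 0 +
          ((∫ x in {x | 1 ≤ (IdeleClassGroup.ideleNorm K x : ℝ)} ∩ 𝓕,
              ideleSum K f x * ((IdeleClassGroup.ideleNorm K x : ℝ) : ℂ) ∂ν) +
            (∫ x in {x | 1 ≤ (IdeleClassGroup.ideleNorm K x : ℝ)} ∩ 𝓕,
              ideleSum K (adeleFourier K μ f) x ∂ν) -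
            ((idelicCovolume K ν).toReal : ℂ) * f 0) := by
  -- names
  set L : Set (GaloisRepresentations.ideleGroup K) :=
    {x | (IdeleClassGroup.ideleNorm K x : ℝ) < 1} with hL
  set G : Set (GaloisRepresentations.ideleGroup K) :=
    {x | 1 ≤ (IdeleClassGroup.ideleNorm K x : ℝ)} with hG
  set LT : Set (GaloisRepresentations.ideleGroup K) :=
    {x | (IdeleClassGroup.ideleNorm K x : ℝ) < T⁻¹} with hLT
  set c : ℂ := adeleFourier K μ f 0 with hc
  have hcont : Continuous fun x : GaloisRepresentations.ideleGroup K =>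
      (IdeleClassGroup.ideleNorm K x : ℝ) :=
    NNReal.continuous_coe.comp (continuous_ideleNorm_holds K)
  have hLm : MeasurableSet L := measurableSet_lt hcont.measurable measurable_const
  have hGm : MeasurableSet G := measurableSet_le measurable_const hcont.measurable
  -- the four pieces as functions on `𝕀_K`
  set F1 : GaloisRepresentations.ideleGroup K → ℂ :=
    G.indicator fun x => ideleSum K f x * ((IdeleClassGroup.ideleNorm K x : ℝ) : ℂ) with hF1
  set F2 : GaloisRepresentations.ideleGroup K → ℂ :=
    L.indicator fun x => ideleSum K (adeleFourier K μ f) x⁻¹ with hF2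
  set F3 : GaloisRepresentations.ideleGroup K → ℂ :=
    fun x => L.indicator (fun _ => c) x - LT.indicator (fun _ => c) x with hF3
  set F4 : GaloisRepresentations.ideleGroup K → ℂ :=
    L.indicator fun x => f 0 * ((IdeleClassGroup.ideleNorm K x : ℝ) : ℂ) with hF4
  have hdec : (fun x => (ideleSum K f x - ((IdeleClassGroup.ideleNorm K x : ℝ) : ℂ)⁻¹ *
      LT.indicator (fun _ => c) x) * ((IdeleClassGroup.ideleNorm K x : ℝ) : ℂ)) =
      fun x => F1 x + F2 x + F3 x - F4 x :=
    funext fun x => tateTruncated_integrand_eq μ hμ hf T x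
  -- integrability and values of the four pieces on `𝓕`
  have h1i : Integrable F1 (ν.restrict 𝓕) := by
    rw [hF1, integrable_indicator_iff hGm, IntegrableOn, Measure.restrict_restrict hGm]
    exact integrableOn_ideleSum_mul_ideleNorm ν h𝓕 hf
  have h1v : ∫ x in 𝓕, F1 x ∂ν = ∫ x in G ∩ 𝓕,
      ideleSum K f x * ((IdeleClassGroup.ideleNorm K x : ℝ) : ℂ) ∂ν := by
    rw [hF1, setIntegral_indicator hGm, inter_comm]
  have hFS : adeleFourier K μ f ∈ schwartzBruhatAdele K := adeleFourier_mem_schwartzBruhatAdele μ hf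
  have h2 := integrableOn_and_setIntegral_ideleSum_inv ν h𝓕 hFS
  have h2i : Integrable F2 (ν.restrict 𝓕) := by
    rw [hF2, integrable_indicator_iff hLm, IntegrableOn, Measure.restrict_restrict hLm]
    exact h2.1
  have h2v : ∫ x in 𝓕, F2 x ∂ν = ∫ x in G ∩ 𝓕, ideleSum K (adeleFourier K μ f) x ∂ν := by
    rw [hF2, setIntegral_indicator hLm, inter_comm, h2.2]
  have h3 := integrableOn_and_setIntegral_indicator_sub_indicator ν h𝓕 hT c
  have h3i : Integrable F3 (ν.restrict 𝓕) := h3.1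
  have h3v : ∫ x in 𝓕, F3 x ∂ν = (((idelicCovolume K ν).toReal * Real.log T : ℝ) : ℂ) * c := h3.2
  have h4 := integrableOn_and_setIntegral_ideleNorm_lt_one ν h𝓕
  have h4i : Integrable F4 (ν.restrict 𝓕) := by
    rw [hF4, integrable_indicator_iff hLm, IntegrableOn, Measure.restrict_restrict hLm]
    exact h4.1.const_mul (f 0)
  have h4v : ∫ x in 𝓕, F4 x ∂ν = ((idelicCovolume K ν).toReal : ℂ) * f 0 := by
    rw [hF4, setIntegral_indicator hLm, inter_comm, integral_const_mul, h4.2, mul_comm]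
  refine ⟨?_, ?_⟩
  · rw [IntegrableOn, hdec]
    exact ((h1i.add h2i).add h3i).sub h4i
  · rw [hdec, integral_sub (f := fun x => F1 x + F2 x + F3 x) (g := F4) ((h1i.add h2i).add h3i) h4i,
      integral_add (f := fun x => F1 x + F2 x) (g := F3) (h1i.add h2i) h3i,
      integral_add (f := F1) (g := F2) h1i h2i, h1v, h2v, h3v, h4v]
    ring

end Main

end Literature.NumberTheory.Automorphic
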